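import Summits.BirchSwinnertonDyer.Rank1Residual.Additive.WildThreeSignatureLocal
import Summits.BirchSwinnertonDyer.Rank1Residual.Additive.MazurTateDivisibilityThree
import Summits.BirchSwinnertonDyer.Rank1Residual.Additive.KodairaCondExpThree
import Summits.BirchSwinnertonDyer.Rank1Residual.Additive.KodairaDictionaryThree
import Summits.BirchSwinnertonDyer.Rank1Residual.Additive.LocIrrValuationCriterionThreeProofs
import Literature.NumberTheory.DiophantineGeometry.ConductorAdditiveProofs
import HarnessLib

/-!
# (T7) `Additive.SignatureDichotomyThree` is a THEOREM, and the `LocIrr(3)` CLASSIFICATION on the wild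
# locus at `3`: a curve of Kodaira type `II / IV / IV* / II*` at `3` satisfies the `c₄/c₆` criterion for
# `W[3]|G_{ℚ₃}` irreducible iff its signature `(v₃c₄, v₃c₆, v₃Δ_min)` is `(2,4,3)` (II) or `(4,7,9)`
# (IV*) — so `f₃ = 3`; `f₃ ∈ {4, 5} ⟹ ¬ LocIrr(3)` — UNCONDITIONALLY, by Tate's algorithm
# (cell `b2b-bsdres`; seat `b2b-bsdres-x11b3-p6` GEN 10 as cross-cell pool hand under the x11b3 lead's
# P-POOL rule; theorems only)

HONEST FRAMING (cell `b2b-bsdres`, run/shared/lean/b2b/bsd-rank1-residual/, verbatim in every file): the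
goal of the cell is to DELETE the COMBINATION-SHAPED residual classes of the Birch–Swinnerton-Dyer formula
for ALL analytic-rank `≤ 1` elliptic curves over `ℚ` — "full BSD formula for every rank `≤ 1` curve in
class `C`" assembled STRICTLY from published theorems — so that the rank-`≤ 1` remainder becomes exactly
the CONSTRUCTION-SHAPED classes, which are TYPED (missing-input `Prop`s), NOT attempted. This is not
"finishing BSD". Lane CLASS-CLOSURE / team o6 (O6 OPEN): research routes; census output is EVIDENCE,
never a Literature fact; nothing is booked; no mark of `RESIDUAL-MAP.md` moves. This file: THEOREMS ONLY
(no definition, no named fact, no `@[conjecture]` node, no `sorry`; net named-fact debt `0`); NO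
hypothesis beyond the binders displayed.

## What is proved

* §1 `addv_three_of_two_le_condExp` (`f₃ ≥ 2 ⟹ Addv W 3`: the tree's `two_le_conductorExponent_iff_holds`
  read at the prime `3` through the prime/place bridges) and `kodairaSymbolAt_wild_of_three_le_condExp`
  (`f₃ ≥ 3 ⟹` Kodaira `II / IV / IV* / II*`: the tame additive types have `f₃ = 2`,
  `condExpTwo_three_of_kodairaSymbolAt_tame`).
* §2 **`signature_of_kodairaSymbolAt_wild_of_locIrrCriterionThree`** — THE CLASSIFICATION: for `W/ℚ`
  globally minimal of wild Kodaira type at `3` satisfying `LocIrrCriterionThree W`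
  (`c₄ ≠ 0 ∧ (c₆ = 0 ∨ 2·v₃c₆ ≥ 3·v₃c₄ + 2)`), the type is `II` with `(v₃c₄, v₃c₆, v₃Δ) = (2,4,3)` or
  `IV*` with `(4,7,9)`, and `f₃ = 3` in both cases.  Route: the wild normal forms on a `ℚ₃`-model
  (`exists_variableChange_b_of_kodairaSymbolAt_wild`, bsd.S15, ATAEC IV.9.4 Steps 3/5/8/10) made
  `ℚ`-rational (`exists_variableChange_valuation_of_adicCompletion`), the wild bound `ord₃ Δ_min ≥ m + 2`
  (`numComponents_add_two_le_ordMinimalDiscriminant_three_of_kodairaSymbolAt_wild`), and the pure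
  valuation lemma `valuation_signature_of_wild_shape` (`Additive/WildThreeSignatureLocal.lean`); since `W`
  is globally minimal, `ord₃ Δ(W) = ord₃ Δ_min`, so the scaling `u` of the change of variables is a
  `3`-adic unit (`variableChange_Δ`) and `ord₃ c₄`, `ord₃ c₆` transfer to `W` (`variableChange_c₄/c₆`);
  `f₃ = ord₃ Δ_min + 1 − m` is the tree's definition of `conductorExponent` (Ogg's formula).
* §3 **`signatureDichotomyThree_holds : SignatureDichotomyThree`** — o6-r1's THEOREM-CANDIDATE (T7) of
  `Additive/MazurTateDivisibilityThree.lean`, binders verbatim (`f₃ = 3 ⟹` wild, then §2).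
* §4 the converse `locIrrCriterionThree_of_signature` (arithmetic) and the `LocIrr` form (criterion ⟺
  `LocIrr W 3` by the tree theorem `locIrrThreeIffCriterion_holds`, L-O56-sel):
  **`locIrr_three_iff_signature_of_wild`** (on the wild locus `LocIrr(3) ⟺` signature `(2,4,3) ∨ (4,7,9)`),
  `kodairaSymbolAt_of_locIrr_three_of_wild`, **`not_locIrr_three_of_condExp_eq_four`** (no `v₃Δ_min`
  hypothesis — cf. `not_locIrr_three_of_cyclic_values'`), **`not_locIrr_three_of_condExp_eq_five`**,
  `condExp_eq_three_of_locIrr_three_of_subW`.  (`v₃(j) = 3` under `LocIrr(3)` — the O6 node (CAN) — is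
  x11b3-p9's class-free `O6/LocIrrThreeJInvariantHolds.lean`; not restated here.)

WORDING (EVIDENCE framing; cc-typer-5 / the o6 planners rule on `TYPED.md` / `TARGETS.md`): "(T7)
`SignatureDichotomyThree` is a THEOREM; on the wild locus at `3`, `LocIrr(3) ⟺` signature `(2,4,3)` (II) or
`(4,7,9)` (IV*), in particular `LocIrr(3) ⟹ f₃ = 3` and `f₃ ∈ {4,5} ⟹ ¬LocIrr(3)` (Tate's
algorithm at `3`: wild normal forms + `c₄, c₆, Δ` in terms of `b₂, b₄, b₆`); the Manoharmayum route of
the T7 docstring is not used; no Galois statement beyond the tree's `LocIrr ↔ criterion` is claimed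
(`NoGoodCompanionOfDiscValThree`, (T8), the O6 (M)/(Λ)/(IRR)/(TW) nodes untouched); censuses 27 550 /
27 550 (T7), 'IRR ⟹ v₃N = 3' 21 / 21 and `LocIrr(3)` = 0 / 5 161 at `f₃ = 4` stay EVIDENCE;
nothing booked; no mark."

References: J. H. Silverman, *Advanced Topics in the Arithmetic of Elliptic Curves*, GTM 151 (1994),
IV.9.4 Steps 3, 5, 8, 10, Table 4.1, IV.10–11 [SilvermanATAEC1994]; I. Papadopoulos, J. Number Theory
44 (1993) 119–152, Tableau II; O. Fouquet, X. Wan, arXiv:2107.13726 Thm 5.1 (the `LocIrr` hypothesis)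
[FouquetWan2021].
-/

noncomputable section

open scoped Classical

open WeierstrassCurve IsDedekindDomain IsDedekindDomain.HeightOneSpectrum WithZero Rat.HeightOneSpectrum
  Literature.NumberTheory.EllipticCurves Literature.NumberTheory.EllipticCurves.Rank1Residual
  Literature.NumberTheory.EllipticCurves.Rank1Residual.Typed Literature.NumberTheory.DiophantineGeometry

namespace Summit.BirchSwinnertonDyer.Rank1Residual.Additive

section Curves

/-- The rational prime below `placeOf 3` is `3`. [folklore] -/
private theorem natGenerator_placeOf_three : natGenerator (placeOf 3) = 3 :=
  Literature.NumberTheory.EllipticCurves.Rat.natGenerator_primesEquiv_symm ⟨3, Nat.prime_three⟩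

/-- `ord_{(3)}(3) = 1`. [folklore] -/
private theorem valuation_placeOf_three_three :
    (placeOf 3).valuation ℚ (3 : ℚ) = exp (-1 : ℤ) := by
  rw [valuation_eq_exp_neg_padicValRat (placeOf 3) three_ne_zero, natGenerator_placeOf_three,
    show (3 : ℚ) = ((3 : ℕ) : ℚ) by norm_num, padicValRat.self (by norm_num)]

/-- `ord_{(3)}(2) = 0`. [folklore] -/
private theorem valuation_placeOf_three_two : (placeOf 3).valuation ℚ (2 : ℚ) = 1 := by
  rw [valuation_eq_exp_neg_padicValRat (placeOf 3) two_ne_zero, natGenerator_placeOf_three]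
  have : padicValRat 3 (2 : ℚ) = 0 := by
    rw [show (2 : ℚ) = ((2 : ℕ) : ℚ) by norm_num, padicValRat.of_nat]
    norm_num [padicValNat.eq_zero_of_not_dvd]
  rw [this, neg_zero, exp_zero]

/-- In `ℤᵐ⁰`: `x ^ n = 1` with `n ≠ 0` forces `x = 1`. [folklore] -/
private theorem eq_one_of_pow_eq_one'' {x : ℤᵐ⁰} {n : ℕ} (hn : n ≠ 0) (h : x ^ n = 1) : x = 1 := by
  rcases lt_trichotomy x 1 with hlt | heq | hgt
  · exact absurd h (pow_lt_one' hlt hn).ne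
  · exact heq
  · exact absurd h (one_lt_pow' hgt hn).ne'

/-- In `ℤᵐ⁰`: `(exp a)ⁿ = exp (n·a)`. [folklore] -/
private theorem exp_pow_natCast' (a : ℤ) (n : ℕ) : (exp a : ℤᵐ⁰) ^ n = exp ((n : ℤ) * a) := by
  rw [← exp_nsmul, nsmul_eq_mul]

variable (W : WeierstrassCurve ℚ) [W.IsElliptic]

/-! ## §1 `f₃ ≥ 2 ⟹ additive`; `f₃ ≥ 3 ⟹ wild Kodaira type` -/

/-- **`f₃ ≥ 2 ⟹ additive at 3`** (`Addv W 3`: neither good nor multiplicative at the prime `3`): the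
tree's `two_le_conductorExponent_iff_holds` (ATAEC IV.10.2 (c), with Ogg's formula as the definition of
`conductorExponent`) at the place `(3)` of `ℤ`, read at the prime through the prime/place bridges.
[cite: SilvermanATAEC1994, IV.10.2 (c)] -/
theorem addv_three_of_two_le_condExp (h : 2 ≤ condExp W 3) : Addv W 3 := by
  haveI : PerfectField (IsLocalRing.ResidueField ((placeOf 3).adicCompletionIntegers ℚ)) :=
    PerfectField.ofFinite
  have hadd : W.HasAdditiveReductionAt (placeOf 3) :=
    (two_le_conductorExponent_iff_holds (placeOf 3) W).mp h
  refine ⟨fun hg ↦ hadd.not_hasGoodReductionAt ?_, fun hm ↦ hadd.not_hasMultiplicativeReductionAt ?_⟩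
  · exact (W.hasGoodReductionAtPrime_iff_hasGoodReductionAt_holds ⟨3, Nat.prime_three⟩).mp hg
  · exact (W.hasMultiplicativeReductionAtPrime_iff_hasMultiplicativeReductionAt_holds
      ⟨3, Nat.prime_three⟩).mp hm

/-- **`f₃ ≥ 3 ⟹` Kodaira `II`, `IV`, `IV*` or `II*` at `3`** (the WILD types): additive by `f₃ ≥ 2`, and
the tame additive types `Iₙ*`, `III`, `III*` have `f₃ = 2`.
[cite: SilvermanATAEC1994, IV Table 4.1 and IV.10–11 (Ogg's formula)] -/
theorem kodairaSymbolAt_wild_of_three_le_condExp (hf : 3 ≤ condExp W 3) :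
    W.kodairaSymbolAt (placeOf 3) = .II ∨ W.kodairaSymbolAt (placeOf 3) = .IV ∨
      W.kodairaSymbolAt (placeOf 3) = .IVstar ∨ W.kodairaSymbolAt (placeOf 3) = .IIstar := by
  have hadd : Addv W 3 := addv_three_of_two_le_condExp W (by omega)
  rcases kodairaSymbolAt_three_cases_of_addv W hadd with ⟨n, hK⟩ | hK | hK | hK
  · exact absurd (condExpTwo_three_of_kodairaSymbolAt_tame W (Or.inr (Or.inr ⟨_, hK⟩))) (by
      unfold CondExpTwo; omega)
  · exact absurd (condExpTwo_three_of_kodairaSymbolAt_tame W (Or.inr (Or.inr ⟨_, hK⟩))) (by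
      unfold CondExpTwo; omega)
  · exact absurd (condExpTwo_three_of_kodairaSymbolAt_tame W (hK.elim Or.inl fun h ↦ Or.inr (Or.inl h)))
      (by unfold CondExpTwo; omega)
  · exact hK

/-! ## §2 The classification on the wild locus -/

variable [W.IsGloballyMinimal]

/-- **The `LocIrr(3)` criterion on the wild locus at `3` — CLASSIFICATION, UNCONDITIONALLY.** For `W/ℚ`
elliptic and globally minimal of Kodaira type `II`, `IV`, `IV*` or `II*` at `3` with
`c₄ ≠ 0 ∧ (c₆ = 0 ∨ 2·v₃c₆ ≥ 3·v₃c₄ + 2)`: the type is `II` with `(v₃c₄, v₃c₆, v₃Δ) = (2,4,3)` or `IV*` with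
`(4,7,9)`, and `f₃ = 3`.  Route: wild normal forms (`exists_variableChange_b_of_kodairaSymbolAt_wild`) made
`ℚ`-rational (`exists_variableChange_valuation_of_adicCompletion`), the wild bound `ord₃ Δ_min ≥ m + 2`,
and `valuation_signature_of_wild_shape`; global minimality makes the scaling a `3`-adic unit, so
`ord₃ c₄`, `ord₃ c₆` are read on `W`; `f₃ = ord₃ Δ_min + 1 − m`. No table, no named fact.
[cite: SilvermanATAEC1994, IV.9.4 Steps 3, 5, 8, 10 and Table 4.1] -/
theorem signature_of_kodairaSymbolAt_wild_of_locIrrCriterionThree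
    (hT : W.kodairaSymbolAt (placeOf 3) = .II ∨ W.kodairaSymbolAt (placeOf 3) = .IV ∨
      W.kodairaSymbolAt (placeOf 3) = .IVstar ∨ W.kodairaSymbolAt (placeOf 3) = .IIstar)
    (hcrit : LocIrrCriterionThree W) :
    (W.kodairaSymbolAt (placeOf 3) = .II ∧ condExp W 3 = 3 ∧
        padicValRat 3 W.c₄ = 2 ∧ padicValRat 3 W.c₆ = 4 ∧ padicValRat 3 W.Δ = 3) ∨
      (W.kodairaSymbolAt (placeOf 3) = .IVstar ∧ condExp W 3 = 3 ∧
        padicValRat 3 W.c₄ = 4 ∧ padicValRat 3 W.c₆ = 7 ∧ padicValRat 3 W.Δ = 9) := by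
  haveI : PerfectField (IsLocalRing.ResidueField ((placeOf 3).adicCompletionIntegers ℚ)) :=
    PerfectField.ofFinite
  have h2 : ringChar (ℤ ⧸ (placeOf 3).asIdeal) ≠ 2 := by rw [ringChar_int_quot_placeOf 3]; decide
  have hπ := valuation_placeOf_three_three
  set w := (placeOf 3).valuation ℚ with hw
  have hw2 : w 2 = 1 := valuation_placeOf_three_two
  -- the wild bound `m + 2 ≤ ord₃ Δ_min` and Ogg's formula
  have hwb := numComponents_add_two_le_ordMinimalDiscriminant_three_of_kodairaSymbolAt_wild W hT
  set e := W.ordMinimalDiscriminant (placeOf 3) with he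
  have hf : condExp W 3 = e + 1 - (W.kodairaSymbolAt (placeOf 3)).numComponents := rfl
  -- `ord₃ Δ(W) = e` (global minimality)
  have hvD : padicValRat 3 W.Δ = (e : ℤ) := by
    rw [← cast_minimalDiscriminantInt W, padicValRat.of_int, ← ordMinimalDiscriminant_placeOf_eq W 3]
  have hWΔ : w W.Δ = exp (-(e : ℤ)) := by
    rw [hw, valuation_eq_exp_neg_padicValRat (placeOf 3) W.isUnit_Δ.ne_zero, natGenerator_placeOf_three,
      hvD]
  -- the criterion in valuation form on `W`
  have hcritW : w W.c₆ ^ 2 ≤ w W.c₄ ^ 3 * exp (-2 : ℤ) := by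
    by_cases hc6 : W.c₆ = 0
    · rw [hc6, map_zero, zero_pow two_ne_zero]; exact zero_le
    · have hle : 3 * padicValRat 3 W.c₄ + 2 ≤ 2 * padicValRat 3 W.c₆ := hcrit.2.resolve_left hc6
      rw [hw, valuation_eq_exp_neg_padicValRat (placeOf 3) hcrit.1,
        valuation_eq_exp_neg_padicValRat (placeOf 3) hc6, natGenerator_placeOf_three, exp_pow_natCast',
        exp_pow_natCast', ← exp_add, exp_le_exp]
      push_cast
      omega
  -- reading `v₃` off `w`
  have hvc₄ : ∀ m : ℤ, w W.c₄ = exp (-m) → padicValRat 3 W.c₄ = m := by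
    intro m hm
    rw [hw, valuation_eq_exp_neg_padicValRat (placeOf 3) hcrit.1, natGenerator_placeOf_three,
      exp_inj] at hm
    omega
  have hvc₆ : ∀ m : ℤ, w W.c₆ = exp (-m) → padicValRat 3 W.c₆ = m := by
    intro m hm
    have hc6 : W.c₆ ≠ 0 := fun h0 ↦ by rw [h0, map_zero] at hm; exact exp_ne_zero hm.symm
    rw [hw, valuation_eq_exp_neg_padicValRat (placeOf 3) hc6, natGenerator_placeOf_three,
      exp_inj] at hm
    omega
  -- reduction to fixed shapes `(k₂, k₄, k₆)` with the wild lower bound on `e`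
  have main : ∀ {k₂ k₄ k₆ : ℕ},
      ((W.kodairaSymbolAt (placeOf 3) = .II ∧ k₂ = 1 ∧ k₄ = 1 ∧ k₆ = 1) ∨
        (W.kodairaSymbolAt (placeOf 3) = .IV ∧ k₂ = 1 ∧ k₄ = 2 ∧ k₆ = 2) ∨
        (W.kodairaSymbolAt (placeOf 3) = .IVstar ∧ k₂ = 2 ∧ k₄ = 3 ∧ k₆ = 4) ∨
        (W.kodairaSymbolAt (placeOf 3) = .IIstar ∧ k₂ = 2 ∧ k₄ = 4 ∧ k₆ = 5)) →
      ((k₂ = 1 ∧ k₄ = 1 ∧ k₆ = 1 ∧ 3 ≤ e) ∨ (k₂ = 1 ∧ k₄ = 2 ∧ k₆ = 2 ∧ 5 ≤ e) ∨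
        (k₂ = 2 ∧ k₄ = 3 ∧ k₆ = 4 ∧ 9 ≤ e) ∨ (k₂ = 2 ∧ k₄ = 4 ∧ k₆ = 5 ∧ 11 ≤ e)) →
      (k₆ = 1 ∧ e = 3 ∧ w W.c₄ = exp (-2 : ℤ) ∧ w W.c₆ = exp (-4 : ℤ)) ∨
        (k₆ = 4 ∧ e = 9 ∧ w W.c₄ = exp (-4 : ℤ) ∧ w W.c₆ = exp (-7 : ℤ)) := by
    intro k₂ k₄ k₆ hT' hk
    obtain ⟨C, β₂, β₄, β₆, δ, hβ₆, hδ, hb₂, hb₄, hb₆, hΔ⟩ :=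
      W.exists_variableChange_b_of_kodairaSymbolAt_wild (placeOf 3) h2 hT' hπ
    rw [← he] at hΔ
    obtain ⟨C', hb₂', hb₄', hb₆', hΔ'⟩ :=
      W.exists_variableChange_valuation_of_adicCompletion (placeOf 3) C hπ hβ₆ hδ hb₂ hb₄ hb₆ hΔ
    -- the scaling is a `3`-adic unit
    have hu12 : w (↑C'.u⁻¹ : ℚ) ^ 12 = 1 := by
      have h := hΔ'
      rw [variableChange_Δ, map_mul, map_pow, hWΔ] at h
      exact mul_right_cancel₀ exp_ne_zero (h.trans (one_mul _).symm)
    have hu : w (↑C'.u⁻¹ : ℚ) = 1 := eq_one_of_pow_eq_one'' (by norm_num) hu12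
    have hYc₄ : w (C' • W).c₄ = w W.c₄ := by
      rw [variableChange_c₄, map_mul, map_pow, hu, one_pow, one_mul]
    have hYc₆ : w (C' • W).c₆ = w W.c₆ := by
      rw [variableChange_c₆, map_mul, map_pow, hu, one_pow, one_mul]
    have key := valuation_signature_of_wild_shape w hπ hw2 (C' • W) hb₂' hb₄' hb₆' hΔ' hk
      (by rw [hYc₄, hYc₆]; exact hcritW)
    rwa [hYc₄, hYc₆] at key
  rcases hT with hK | hK | hK | hK <;> have hm := hwb <;> rw [hK] at hm hf <;>
    simp only [KodairaSymbol.numComponents] at hm hf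
  · rcases main (Or.inl ⟨hK, rfl, rfl, rfl⟩) (Or.inl ⟨rfl, rfl, rfl, hm⟩) with
      ⟨-, he3, h4, h6⟩ | ⟨hk6, -⟩
    · refine Or.inl ⟨hK, by omega, hvc₄ 2 h4, hvc₆ 4 h6, ?_⟩
      rw [hvD, he3]; rfl
    · exact absurd hk6 (by norm_num)
  · rcases main (Or.inr (Or.inl ⟨hK, rfl, rfl, rfl⟩)) (Or.inr (Or.inl ⟨rfl, rfl, rfl, hm⟩)) with
      ⟨hk6, -⟩ | ⟨hk6, -⟩
    · exact absurd hk6 (by norm_num)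
    · exact absurd hk6 (by norm_num)
  · rcases main (Or.inr (Or.inr (Or.inl ⟨hK, rfl, rfl, rfl⟩))) (Or.inr (Or.inr (Or.inl ⟨rfl, rfl, rfl, hm⟩)))
      with ⟨hk6, -⟩ | ⟨-, he9, h4, h6⟩
    · exact absurd hk6 (by norm_num)
    · refine Or.inr ⟨hK, by omega, hvc₄ 4 h4, hvc₆ 7 h6, ?_⟩
      rw [hvD, he9]; rfl
  · rcases main (Or.inr (Or.inr (Or.inr ⟨hK, rfl, rfl, rfl⟩))) (Or.inr (Or.inr (Or.inr ⟨rfl, rfl, rfl, hm⟩)))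
      with ⟨hk6, -⟩ | ⟨hk6, -⟩
    · exact absurd hk6 (by norm_num)
    · exact absurd hk6 (by norm_num)

/-! ## §3 (T7) `SignatureDichotomyThree` -/

/-- **(T7) per curve, UNCONDITIONALLY.** For `W/ℚ` elliptic and globally minimal with `f₃ = 3` satisfying
the `c₄/c₆` criterion: `(v₃c₄, v₃c₆, v₃Δ) = (2,4,3)` or `(4,7,9)` (`f₃ = 3 ⟹` wild type, then §2).
[cite: SilvermanATAEC1994, IV.9.4 Steps 3, 5, 8, 10 and Table 4.1] -/
theorem signature_of_condExp_three_of_locIrrCriterionThree (hf : condExp W 3 = 3)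
    (hcrit : LocIrrCriterionThree W) :
    (padicValRat 3 W.c₄ = 2 ∧ padicValRat 3 W.c₆ = 4 ∧ padicValRat 3 W.Δ = 3) ∨
      (padicValRat 3 W.c₄ = 4 ∧ padicValRat 3 W.c₆ = 7 ∧ padicValRat 3 W.Δ = 9) := by
  rcases signature_of_kodairaSymbolAt_wild_of_locIrrCriterionThree W
      (kodairaSymbolAt_wild_of_three_le_condExp W (by omega)) hcrit with
    ⟨-, -, h⟩ | ⟨-, -, h⟩
  · exact Or.inl h
  · exact Or.inr h

/-- **(T7) `SignatureDichotomyThree` HOLDS** (o6-r1's THEOREM-CANDIDATE in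
`Additive/MazurTateDivisibilityThree.lean`, binders verbatim): for `W/ℚ` globally minimal with `f₃ = 3`
satisfying the `c₄/c₆` criterion for `W[3]|G_{ℚ₃}` irreducible, the signature `(v₃c₄, v₃c₆, v₃Δ)` is
`(2,4,3)` (Kodaira II) or `(4,7,9)` (Kodaira IV*).  CENSUS 27 550 / 27 550 stays EVIDENCE; the
Manoharmayum route of the docstring is not used; nothing booked; no mark.
[cite: SilvermanATAEC1994, IV.9.4 Steps 3, 5, 8, 10 and Table 4.1] -/
theorem signatureDichotomyThree_holds : SignatureDichotomyThree :=
  fun W _ _ hf hcrit ↦ signature_of_condExp_three_of_locIrrCriterionThree W hf hcrit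

/-! ## §4 The `LocIrr(3)` form: `f₃ = 3`, types II / IV*; `f₃ ∈ {4, 5} ⟹ ¬ LocIrr` -/

omit [W.IsElliptic] [W.IsGloballyMinimal] in
/-- **Converse (arithmetic): the signatures `(2,4,·)` and `(4,7,·)` satisfy the `c₄/c₆` criterion**
(`2·4 ≥ 3·2 + 2`, `2·7 ≥ 3·4 + 2`; `v₃(0) = 0` makes `c₄ ≠ 0`, `c₆ ≠ 0` automatic). [folklore] -/
theorem locIrrCriterionThree_of_signature
    (h : (padicValRat 3 W.c₄ = 2 ∧ padicValRat 3 W.c₆ = 4) ∨ (padicValRat 3 W.c₄ = 4 ∧ padicValRat 3 W.c₆ = 7)) :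
    LocIrrCriterionThree W := by
  have hc4 : W.c₄ ≠ 0 := by
    rintro h0; rw [h0, padicValRat.zero] at h; omega
  exact ⟨hc4, Or.inr (by omega)⟩

/-- **`LocIrr(3)` on the wild locus at `3` ⟺ signature `(2,4,3)` or `(4,7,9)`** (`LocIrr ↔` criterion by
`locIrrThreeIffCriterion_holds`; `⟹` by §2, `⟸` by the arithmetic converse). [folklore] -/
theorem locIrr_three_iff_signature_of_wild
    (hT : W.kodairaSymbolAt (placeOf 3) = .II ∨ W.kodairaSymbolAt (placeOf 3) = .IV ∨
      W.kodairaSymbolAt (placeOf 3) = .IVstar ∨ W.kodairaSymbolAt (placeOf 3) = .IIstar) :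
    LocIrr W 3 ↔
      ((padicValRat 3 W.c₄ = 2 ∧ padicValRat 3 W.c₆ = 4 ∧ padicValRat 3 W.Δ = 3) ∨
        (padicValRat 3 W.c₄ = 4 ∧ padicValRat 3 W.c₆ = 7 ∧ padicValRat 3 W.Δ = 9)) := by
  rw [locIrrThreeIffCriterion_holds W]
  refine ⟨fun hcrit ↦ ?_, fun h ↦ locIrrCriterionThree_of_signature W ?_⟩
  · rcases signature_of_kodairaSymbolAt_wild_of_locIrrCriterionThree W hT hcrit with
      ⟨-, -, h⟩ | ⟨-, -, h⟩
    · exact Or.inl h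
    · exact Or.inr h
  · rcases h with ⟨h4, h6, -⟩ | ⟨h4, h6, -⟩
    · exact Or.inl ⟨h4, h6⟩
    · exact Or.inr ⟨h4, h6⟩

/-- **`LocIrr(3)` on the wild locus ⟹ type II with `(2,4,3)` or IV* with `(4,7,9)`, `f₃ = 3`** (the
criterion supplied by the tree theorem `locIrrThreeIffCriterion_holds`). [folklore] -/
theorem kodairaSymbolAt_of_locIrr_three_of_wild
    (hT : W.kodairaSymbolAt (placeOf 3) = .II ∨ W.kodairaSymbolAt (placeOf 3) = .IV ∨
      W.kodairaSymbolAt (placeOf 3) = .IVstar ∨ W.kodairaSymbolAt (placeOf 3) = .IIstar)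
    (hL : LocIrr W 3) :
    (W.kodairaSymbolAt (placeOf 3) = .II ∧ condExp W 3 = 3 ∧
        padicValRat 3 W.c₄ = 2 ∧ padicValRat 3 W.c₆ = 4 ∧ padicValRat 3 W.Δ = 3) ∨
      (W.kodairaSymbolAt (placeOf 3) = .IVstar ∧ condExp W 3 = 3 ∧
        padicValRat 3 W.c₄ = 4 ∧ padicValRat 3 W.c₆ = 7 ∧ padicValRat 3 W.Δ = 9) :=
  signature_of_kodairaSymbolAt_wild_of_locIrrCriterionThree W hT ((locIrrThreeIffCriterion_holds W).mp hL)

/-- **`LocIrr(3)` with `f₃ ≥ 3` forces `f₃ = 3`.** [folklore] -/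
theorem condExp_eq_three_of_locIrr_three_of_three_le (hf : 3 ≤ condExp W 3) (hL : LocIrr W 3) :
    condExp W 3 = 3 := by
  rcases kodairaSymbolAt_of_locIrr_three_of_wild W (kodairaSymbolAt_wild_of_three_le_condExp W hf) hL with
    ⟨-, h, -⟩ | ⟨-, h, -⟩ <;> exact h

/-- **`f₃ = 4 ⟹ ¬ LocIrr(3)`**, with NO hypothesis on `v₃Δ_min` (which is automatically `4, 6, 10, 12`;
cf. `not_locIrr_three_of_cyclic_values'` of `Additive/CondExpFourUnitPartLawThreeHolds.lean`): the
`f₃ = 4` rows never meet the Fouquet–Wan `LocIrr` locus. CENSUS `LocIrr(3)` = 0 / 5 161 stays EVIDENCE.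
[folklore] -/
theorem not_locIrr_three_of_condExp_eq_four (hf : condExp W 3 = 4) : ¬ LocIrr W 3 := fun hL ↦ by
  have := condExp_eq_three_of_locIrr_three_of_three_le W (by omega) hL
  omega

/-- **`f₃ = 5 ⟹ ¬ LocIrr(3)`**: the `243 ∥ N` rows never meet the Fouquet–Wan `LocIrr` locus.
[folklore] -/
theorem not_locIrr_three_of_condExp_eq_five (hf : condExp W 3 = 5) : ¬ LocIrr W 3 := fun hL ↦ by
  have := condExp_eq_three_of_locIrr_three_of_three_le W (by omega) hL
  omega

/-- **On the wild cell (w): `LocIrr(3) ⟹ f₃ = 3`** (`Addv W 3 ∧ SubW W 3`, i.e. class O6 at `3`).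
[folklore] -/
theorem condExp_eq_three_of_locIrr_three_of_subW (hadd : Addv W 3) (hW : SubW W 3) (hL : LocIrr W 3) :
    condExp W 3 = 3 := by
  rcases kodairaSymbolAt_of_locIrr_three_of_wild W ((subW_three_iff_kodairaSymbolAt_wild W hadd).mp hW) hL
    with ⟨-, h, -⟩ | ⟨-, h, -⟩ <;> exact h

end Curves

end Summit.BirchSwinnertonDyer.Rank1Residual.Additive

end
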